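import Summits.QuantumFields.YangMills.Theorems.LuscherReductionTwistedTraceScalingBOStiffDoor
import HarnessLib

/-!
# THE (B-ST) DOOR WITH KILLING SLACK: the flat Poincaré inequality may carry `+ δ·∫_S g²D` (censored-vs-global jump kernels), the gap drops by `C_νC'_νδ`
# (lane A of S-BASE, crux `TwistedTraceScaling` stmt-QuantumFields-20203, C4-CORE, the (B-ST) pen; design card `pub/ym-fleet/ym-luscher-20007-p1/Lines-BST-poincare.md` (D3), HANDOFF-g21 finding 3;
# cdisprove ✓p736323 `…Negative.BOStiffDoorGainCeiling` (P))

The flat reference Poincaré inequality that feeds `…BOStiffDoor.form_le_of_quasimode_of_comparison` is the CENSORED one on the support of the profile (the door's `hJ` forces the flat jump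
kernel to vanish where `Θ = 0`), whereas `…MehlerPoincare.mehler_poincare_normal` is GLOBAL on `ℝ^σ`.  Global ⇒ censored holds only up to the KILLING term of jumps leaving the ball,
`κ(x) = ∫_{outside} J_flat(x,y) dy ≤ δ·D(x)` with `δ = e^{−cℓ²}` on the fibre ball of record.  This file re-runs the door with that slack:
* ★★ `variance_le_of_comparison_slack` — `hflat : ∫_S g²D − (∫_S gD)²/∫_S D ≤ P₀·½∫∫(g−g')²J₀ + δ·∫_S g²D` and the two-sided weight comparison `Θ²w ≤ C_νD`, `D ≤ C'_νΘ²w` on `S` give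
  `Var_{Θ²w}(g) ≤ (C_νP₀/c_J)·½∫∫(g−g')²ΘMΘ + C_νC'_νδ·∫ g²Θ²w`;
* ★★ `form_le_of_quasimode_of_poincare_slack` — with `hPoinc : Λ·Var ≤ P·½(jump) + Λδ'·∫g²Θ²w`: `∫∫(gΘ)M(gΘ) ≤ Λ[(1 + η − (1−δ')/P)∫g²Θ²w + (1/P)(∫gΘ²w)²/Z]`;
* ★★★ `form_le_of_quasimode_of_comparison_slack` — the composite: gain `θ = (c_J/(C_νP₀))·(1 − C_νC'_νδ) − η`.
HONEST FRAMING: measure-theoretic bookkeeping for a stub of a child of the CONDITIONAL route R2b1; (B-ST) OPEN; C4-CORE OPEN; not infinite volume, not a gap, not Clay.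
-/

set_option autoImplicit false

noncomputable section

open MeasureTheory

namespace Summit.QuantumFields.YangMills.Theorems.FemtoTransferGap.StiffDoor

variable {X : Type*} [MeasurableSpace X] {μ : Measure X} [IsFiniteMeasure μ]

section Slack

variable {M J₀ : X → X → ℝ} {Θ g w D : X → ℝ} {CM CΘ Cg Cw CD CJ : ℝ} {S : Set X} {η Λ P Cν C'ν cJ P₀ δ δ' : ℝ}

/-- ★★ **The stiff bound from an upper quasimode and a Poincaré inequality WITH SLACK** `Λ·(∫g²Θ²w − (∫gΘ²w)²/Z) ≤ P·½∫∫(g−g')²ΘMΘ + Λδ'∫g²Θ²w`: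
`∫∫ (gΘ)M(gΘ) ≤ Λ·[(1 + η − (1−δ')/P)·∫g²Θ²w + (1/P)·(∫gΘ²w)²/Z]`. [cite: Helffer2013, §7] -/
theorem form_le_of_quasimode_of_poincare_slack (hM : Measurable (Function.uncurry M)) (hMb : ∀ x y, |M x y| ≤ CM) (hsymm : ∀ x y, M x y = M y x)
    (hΘ : Measurable Θ) (hΘb : ∀ x, |Θ x| ≤ CΘ) (hΘ0 : ∀ x, 0 ≤ Θ x) (hg : Measurable g) (hgb : ∀ x, |g x| ≤ Cg) (hgS : ∀ x, x ∉ S → g x = 0)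
    (hw : Measurable w) (hwb : ∀ x, |w x| ≤ Cw)
    (hq : ∀ x ∈ S, ∫ y, M x y * Θ y ∂μ ≤ (1 + η) * Λ * (Θ x * w x)) (hP : 0 < P)
    (hPoinc : Λ * ((∫ x, g x ^ 2 * (Θ x ^ 2 * w x) ∂μ) - (∫ x, g x * (Θ x ^ 2 * w x) ∂μ) ^ 2 / ∫ x in S, Θ x ^ 2 * w x ∂μ) ≤
      P * ((1 / 2) * ∫ x, ∫ y, (g x - g y) ^ 2 * (Θ x * M x y * Θ y) ∂μ ∂μ) + Λ * δ' * ∫ x, g x ^ 2 * (Θ x ^ 2 * w x) ∂μ) :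
    ∫ x, ∫ y, (g x * Θ x) * M x y * (g y * Θ y) ∂μ ∂μ ≤
      Λ * ((1 + η - (1 - δ') / P) * ∫ x, g x ^ 2 * (Θ x ^ 2 * w x) ∂μ + (1 / P) * ((∫ x, g x * (Θ x ^ 2 * w x) ∂μ) ^ 2 / ∫ x in S, Θ x ^ 2 * w x ∂μ)) := by
  rw [groundState_identity (μ := μ) hM hMb hsymm hΘ hΘb hg hgb]
  have hmid := quasimode_term_le (μ := μ) (η := η) (Λ := Λ) hM hMb hΘ hΘb hΘ0 hg hgb hgS hw hwb hq
  set N := ∫ x, g x ^ 2 * (Θ x ^ 2 * w x) ∂μ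
  set m := ∫ x, g x * (Θ x ^ 2 * w x) ∂μ
  set Z := ∫ x in S, Θ x ^ 2 * w x ∂μ
  set Dj := ∫ x, ∫ y, (g x - g y) ^ 2 * (Θ x * M x y * Θ y) ∂μ ∂μ
  have h2 : (Λ * (N - m ^ 2 / Z) - Λ * δ' * N) / P ≤ (1 / 2) * Dj := by
    rw [div_le_iff₀ hP]; linarith [hPoinc]
  have key : (∫ x, g x ^ 2 * Θ x * (∫ y, M x y * Θ y ∂μ) ∂μ) - (1 / 2) * Dj ≤ (1 + η) * Λ * N - (Λ * (N - m ^ 2 / Z) - Λ * δ' * N) / P := by linarith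
  refine key.trans (le_of_eq ?_)
  field_simp
  ring

/-- ★★ **Poincaré transfer with killing slack**: if `Θ²w ≤ C_νD` and `D ≤ C'_νΘ²w` on `S`, `c_J·J₀ ≤ ΘMΘ` (`c_J > 0`), and the flat pair satisfies
`∫_S g²D − (∫_S gD)²/∫_S D ≤ P₀·½∫∫(g−g')²J₀ + δ·∫_S g²D` (`P₀, δ ≥ 0`; `C_ν ≥ 0`), then
`∫ g²Θ²w − (∫ gΘ²w)²/∫_S Θ²w ≤ (C_νP₀/c_J)·½∫∫(g−g')²ΘMΘ + C_νδC'_ν·∫ g²Θ²w`. [folklore] -/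
theorem variance_le_of_comparison_slack (hM : Measurable (Function.uncurry M)) (hMb : ∀ x y, |M x y| ≤ CM) (hΘ : Measurable Θ) (hΘb : ∀ x, |Θ x| ≤ CΘ)
    (hg : Measurable g) (hgb : ∀ x, |g x| ≤ Cg) (hgS : ∀ x, x ∉ S → g x = 0) (hw : Measurable w) (hwb : ∀ x, |w x| ≤ Cw)
    (hD : Measurable D) (hDb : ∀ x, |D x| ≤ CD) (hJ₀ : Measurable (Function.uncurry J₀)) (hJ₀b : ∀ x y, |J₀ x y| ≤ CJ)
    (hS : MeasurableSet S) (hν : ∀ x ∈ S, Θ x ^ 2 * w x ≤ Cν * D x) (hCν : 0 ≤ Cν) (hν' : ∀ x ∈ S, D x ≤ C'ν * (Θ x ^ 2 * w x))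
    (hJ : ∀ x y, cJ * J₀ x y ≤ Θ x * M x y * Θ y) (hcJ : 0 < cJ) (hP₀ : 0 ≤ P₀) (hδ : 0 ≤ δ)
    (hZ : 0 < ∫ x in S, Θ x ^ 2 * w x ∂μ) (hZD : 0 < ∫ x in S, D x ∂μ)
    (hflat : (∫ x in S, g x ^ 2 * D x ∂μ) - (∫ x in S, g x * D x ∂μ) ^ 2 / (∫ x in S, D x ∂μ) ≤
      P₀ * ((1 / 2) * ∫ x, ∫ y, (g x - g y) ^ 2 * J₀ x y ∂μ ∂μ) + δ * ∫ x in S, g x ^ 2 * D x ∂μ) :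
    (∫ x, g x ^ 2 * (Θ x ^ 2 * w x) ∂μ) - (∫ x, g x * (Θ x ^ 2 * w x) ∂μ) ^ 2 / (∫ x in S, Θ x ^ 2 * w x ∂μ) ≤
      (Cν * P₀ / cJ) * ((1 / 2) * ∫ x, ∫ y, (g x - g y) ^ 2 * (Θ x * M x y * Θ y) ∂μ ∂μ) + Cν * δ * C'ν * ∫ x, g x ^ 2 * (Θ x ^ 2 * w x) ∂μ := by
  -- run the slack-free transfer with the kernel `J₀` and the "Poincaré constant" absorbing the slack is not linear; instead redo the three steps.
  have hν_m : Measurable fun x => Θ x ^ 2 * w x := (hΘ.pow_const 2).mul hw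
  have hν_b : ∀ x, |Θ x ^ 2 * w x| ≤ CΘ ^ 2 * Cw := fun x => by
    rw [abs_mul, abs_pow]; exact mul_le_mul (pow_le_pow_left₀ (abs_nonneg _) (hΘb x) 2) (hwb x) (abs_nonneg _) (sq_nonneg _)
  have hCg : ∀ z, 0 ≤ Cg := fun z => (abs_nonneg _).trans (hgb z)
  have hsq : ∀ z, |g z ^ 2| ≤ Cg ^ 2 := fun z => by rw [abs_pow]; exact pow_le_pow_left₀ (abs_nonneg _) (hgb z) 2
  have eN : (∫ x, g x ^ 2 * (Θ x ^ 2 * w x) ∂μ) = ∫ x in S, g x ^ 2 * (Θ x ^ 2 * w x) ∂μ :=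
    (setIntegral_eq_integral_of_forall_compl_eq_zero fun x hx => by simp [hgS x hx]).symm
  have em : (∫ x, g x * (Θ x ^ 2 * w x) ∂μ) = ∫ x in S, g x * (Θ x ^ 2 * w x) ∂μ :=
    (setIntegral_eq_integral_of_forall_compl_eq_zero fun x hx => by simp [hgS x hx]).symm
  set a : ℝ := (∫ x in S, g x * D x ∂μ) / ∫ x in S, D x ∂μ with ha
  -- (a) variance ≤ mean square deviation from the flat mean
  have h1 := variance_le_sq_dev (μ := μ) (S := S) hν_m hν_b hg hgb hZ a
  rw [← eN, ← em] at h1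
  -- (b) weight comparison
  have idev : ∀ {ρ : X → ℝ} {Cρ : ℝ}, Measurable ρ → (∀ x, |ρ x| ≤ Cρ) → Integrable (fun x => (g x - a) ^ 2 * ρ x) (μ.restrict S) := fun {ρ Cρ} hρ hρb =>
    integrableOn_of_bdd (((hg.sub measurable_const).pow_const 2).mul hρ) (C := (Cg + |a|) ^ 2 * Cρ) fun x => by
      rw [abs_mul, abs_pow]
      exact mul_le_mul (pow_le_pow_left₀ (abs_nonneg _) ((abs_sub (g x) a).trans (add_le_add_left (hgb x) _)) 2) (hρb x) (abs_nonneg _) (sq_nonneg _)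
  have h2 : ∫ x in S, (g x - a) ^ 2 * (Θ x ^ 2 * w x) ∂μ ≤ ∫ x in S, Cν * ((g x - a) ^ 2 * D x) ∂μ := by
    refine setIntegral_mono_on (idev hν_m hν_b) ((idev hD hDb).const_mul Cν) hS fun x hx => ?_
    have := hν x hx
    nlinarith [sq_nonneg (g x - a)]
  rw [integral_const_mul] at h2
  -- (c) the flat mean square deviation is the flat variance
  have iND : Integrable (fun x => g x ^ 2 * D x) (μ.restrict S) := integrableOn_of_bdd ((hg.pow_const 2).mul hD) (C := Cg ^ 2 * CD) fun x => by
    rw [abs_mul]; exact mul_le_mul (hsq x) (hDb x) (abs_nonneg _) (sq_nonneg _)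
  have imD : Integrable (fun x => g x * D x) (μ.restrict S) := integrableOn_of_bdd (hg.mul hD) (C := Cg * CD) fun x => by
    rw [abs_mul]; exact mul_le_mul (hgb x) (hDb x) (abs_nonneg _) (hCg x)
  have iZD : Integrable D (μ.restrict S) := integrableOn_of_bdd hD hDb
  have h3 : ∫ x in S, (g x - a) ^ 2 * D x ∂μ = (∫ x in S, g x ^ 2 * D x ∂μ) - (∫ x in S, g x * D x ∂μ) ^ 2 / (∫ x in S, D x ∂μ) := by
    have e : ∫ x in S, (g x - a) ^ 2 * D x ∂μ = ∫ x in S, ((g x ^ 2 * D x - (2 * a) * (g x * D x)) + a ^ 2 * D x) ∂μ :=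
      integral_congr_ae (ae_of_all _ fun x => by ring)
    have i1 : Integrable (fun x => g x ^ 2 * D x - (2 * a) * (g x * D x)) (μ.restrict S) := iND.sub (imD.const_mul _)
    have i2 : Integrable (fun x => a ^ 2 * D x) (μ.restrict S) := iZD.const_mul _
    rw [e, integral_add i1 i2, integral_sub iND (imD.const_mul _), integral_const_mul, integral_const_mul, ha]
    field_simp
    ring
  -- (d) jump comparison
  have hdJ : Measurable (Function.uncurry fun x y => (g x - g y) ^ 2 * J₀ x y) := ((( hg.comp measurable_fst).sub (hg.comp measurable_snd)).pow_const 2).mul hJ₀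
  have hdJb : ∀ x y, |(g x - g y) ^ 2 * J₀ x y| ≤ (2 * Cg) ^ 2 * CJ := fun x y => by
    rw [abs_mul, abs_pow]
    exact mul_le_mul (pow_le_pow_left₀ (abs_nonneg _) ((abs_sub _ _).trans (by linarith [hgb x, hgb y])) 2) (hJ₀b x y) (abs_nonneg _) (sq_nonneg _)
  obtain ⟨-, -, -, m4⟩ := measurable_integrands (M := M) (g := g) hM hΘ hg
  have b4 := fun x y => (abs_integrands_le (M := M) hMb hΘb hgb x y).2.2.2
  have h4 : cJ * ∫ x, ∫ y, (g x - g y) ^ 2 * J₀ x y ∂μ ∂μ ≤ ∫ x, ∫ y, (g x - g y) ^ 2 * (Θ x * M x y * Θ y) ∂μ ∂μ := by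
    rw [integral_integral_eq_prod (μ := μ) hdJ hdJb, integral_integral_eq_prod (μ := μ) m4 b4, ← integral_const_mul]
    refine integral_mono ((integrable_prod_of_bdd (μ := μ) hdJ hdJb).const_mul cJ) (integrable_prod_of_bdd (μ := μ) m4 b4) fun p => ?_
    dsimp only [Function.uncurry]
    have := hJ p.1 p.2
    nlinarith [sq_nonneg (g p.1 - g p.2)]
  have h4' : ∫ x, ∫ y, (g x - g y) ^ 2 * J₀ x y ∂μ ∂μ ≤ (1 / cJ) * ∫ x, ∫ y, (g x - g y) ^ 2 * (Θ x * M x y * Θ y) ∂μ ∂μ := by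
    rw [one_div, ← div_eq_inv_mul]; exact (le_div_iff₀' hcJ).mpr h4
  -- (e) the slack term: `∫_S g²D ≤ C'_ν ∫_S g²Θ²w = C'_ν ∫ g²Θ²w`
  have iNν : Integrable (fun x => g x ^ 2 * (Θ x ^ 2 * w x)) (μ.restrict S) := integrableOn_of_bdd ((hg.pow_const 2).mul hν_m) (C := Cg ^ 2 * (CΘ ^ 2 * Cw)) fun x => by
    rw [abs_mul]; exact mul_le_mul (hsq x) (hν_b x) (abs_nonneg _) (sq_nonneg _)
  have h5 : ∫ x in S, g x ^ 2 * D x ∂μ ≤ C'ν * ∫ x, g x ^ 2 * (Θ x ^ 2 * w x) ∂μ := by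
    rw [eN, ← integral_const_mul]
    refine setIntegral_mono_on iND (iNν.const_mul _) hS fun x hx => ?_
    have := hν' x hx
    nlinarith [sq_nonneg (g x)]
  calc (∫ x, g x ^ 2 * (Θ x ^ 2 * w x) ∂μ) - (∫ x, g x * (Θ x ^ 2 * w x) ∂μ) ^ 2 / (∫ x in S, Θ x ^ 2 * w x ∂μ)
      ≤ ∫ x in S, (g x - a) ^ 2 * (Θ x ^ 2 * w x) ∂μ := h1
    _ ≤ Cν * ∫ x in S, (g x - a) ^ 2 * D x ∂μ := h2
    _ = Cν * ((∫ x in S, g x ^ 2 * D x ∂μ) - (∫ x in S, g x * D x ∂μ) ^ 2 / (∫ x in S, D x ∂μ)) := by rw [h3]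
    _ ≤ Cν * (P₀ * ((1 / 2) * ∫ x, ∫ y, (g x - g y) ^ 2 * J₀ x y ∂μ ∂μ) + δ * ∫ x in S, g x ^ 2 * D x ∂μ) := mul_le_mul_of_nonneg_left hflat hCν
    _ ≤ Cν * (P₀ * ((1 / 2) * ((1 / cJ) * ∫ x, ∫ y, (g x - g y) ^ 2 * (Θ x * M x y * Θ y) ∂μ ∂μ)) + δ * (C'ν * ∫ x, g x ^ 2 * (Θ x ^ 2 * w x) ∂μ)) :=
        mul_le_mul_of_nonneg_left (add_le_add (mul_le_mul_of_nonneg_left (mul_le_mul_of_nonneg_left h4' (by norm_num)) hP₀) (mul_le_mul_of_nonneg_left h5 hδ)) hCν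
    _ = (Cν * P₀ / cJ) * ((1 / 2) * ∫ x, ∫ y, (g x - g y) ^ 2 * (Θ x * M x y * Θ y) ∂μ ∂μ) + Cν * δ * C'ν * ∫ x, g x ^ 2 * (Θ x ^ 2 * w x) ∂μ := by ring

/-- ★★★ **THE (B-ST) DOOR WITH KILLING SLACK.**  As `…BOStiffDoor.form_le_of_quasimode_of_comparison`, with the flat Poincaré inequality allowed the slack `+ δ·∫_S g²D` and the extra
lower weight comparison `D ≤ C'_ν Θ²w` on `S`:  `∫∫ (gΘ)M(gΘ) ≤ Λ·[(1 + η − (c_J/(C_νP₀))·(1 − C_νδC'_ν))·∫ g²Θ²w + (c_J/(C_νP₀))·(∫ gΘ²w)²/∫_S Θ²w]`. [cite: Helffer2013, §7] -/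
theorem form_le_of_quasimode_of_comparison_slack (hM : Measurable (Function.uncurry M)) (hMb : ∀ x y, |M x y| ≤ CM) (hsymm : ∀ x y, M x y = M y x)
    (hΘ : Measurable Θ) (hΘb : ∀ x, |Θ x| ≤ CΘ) (hΘ0 : ∀ x, 0 ≤ Θ x) (hg : Measurable g) (hgb : ∀ x, |g x| ≤ Cg) (hgS : ∀ x, x ∉ S → g x = 0)
    (hw : Measurable w) (hwb : ∀ x, |w x| ≤ Cw) (hD : Measurable D) (hDb : ∀ x, |D x| ≤ CD) (hJ₀ : Measurable (Function.uncurry J₀)) (hJ₀b : ∀ x y, |J₀ x y| ≤ CJ)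
    (hS : MeasurableSet S) (hZ : 0 < ∫ x in S, Θ x ^ 2 * w x ∂μ) (hZD : 0 < ∫ x in S, D x ∂μ) (hΛ : 0 < Λ)
    (hq : ∀ x ∈ S, ∫ y, M x y * Θ y ∂μ ≤ (1 + η) * Λ * (Θ x * w x)) (hν : ∀ x ∈ S, Θ x ^ 2 * w x ≤ Cν * D x) (hCν : 0 < Cν)
    (hν' : ∀ x ∈ S, D x ≤ C'ν * (Θ x ^ 2 * w x)) (hJ : ∀ x y, cJ * (Λ * J₀ x y) ≤ Θ x * M x y * Θ y) (hcJ : 0 < cJ) (hP₀ : 0 < P₀) (hδ : 0 ≤ δ)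
    (hflat : (∫ x in S, g x ^ 2 * D x ∂μ) - (∫ x in S, g x * D x ∂μ) ^ 2 / (∫ x in S, D x ∂μ) ≤
      P₀ * ((1 / 2) * ∫ x, ∫ y, (g x - g y) ^ 2 * J₀ x y ∂μ ∂μ) + δ * ∫ x in S, g x ^ 2 * D x ∂μ) :
    ∫ x, ∫ y, (g x * Θ x) * M x y * (g y * Θ y) ∂μ ∂μ ≤
      Λ * ((1 + η - (cJ / (Cν * P₀)) * (1 - Cν * δ * C'ν)) * ∫ x, g x ^ 2 * (Θ x ^ 2 * w x) ∂μ +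
        (cJ / (Cν * P₀)) * ((∫ x, g x * (Θ x ^ 2 * w x) ∂μ) ^ 2 / ∫ x in S, Θ x ^ 2 * w x ∂μ)) := by
  have hJΛ : Measurable (Function.uncurry fun x y => Λ * J₀ x y) := hJ₀.const_mul Λ
  have hJΛb : ∀ x y, |Λ * J₀ x y| ≤ |Λ| * CJ := fun x y => by rw [abs_mul]; exact mul_le_mul_of_nonneg_left (hJ₀b x y) (abs_nonneg _)
  have hflat' : (∫ x in S, g x ^ 2 * D x ∂μ) - (∫ x in S, g x * D x ∂μ) ^ 2 / (∫ x in S, D x ∂μ) ≤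
      (P₀ / Λ) * ((1 / 2) * ∫ x, ∫ y, (g x - g y) ^ 2 * (Λ * J₀ x y) ∂μ ∂μ) + δ * ∫ x in S, g x ^ 2 * D x ∂μ := by
    have e : ∫ x, ∫ y, (g x - g y) ^ 2 * (Λ * J₀ x y) ∂μ ∂μ = Λ * ∫ x, ∫ y, (g x - g y) ^ 2 * J₀ x y ∂μ ∂μ := by
      rw [← integral_const_mul]
      refine integral_congr_ae (ae_of_all _ fun x => ?_)
      dsimp only
      rw [← integral_const_mul]
      refine integral_congr_ae (ae_of_all _ fun y => ?_); dsimp only; ring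
    rw [e]
    calc _ ≤ P₀ * ((1 / 2) * ∫ x, ∫ y, (g x - g y) ^ 2 * J₀ x y ∂μ ∂μ) + δ * ∫ x in S, g x ^ 2 * D x ∂μ := hflat
      _ = (P₀ / Λ) * ((1 / 2) * (Λ * ∫ x, ∫ y, (g x - g y) ^ 2 * J₀ x y ∂μ ∂μ)) + δ * ∫ x in S, g x ^ 2 * D x ∂μ := by field_simp
  have hV := variance_le_of_comparison_slack (μ := μ) (J₀ := fun x y => Λ * J₀ x y) hM hMb hΘ hΘb hg hgb hgS hw hwb hD hDb hJΛ hJΛb hS hν hCν.le hν' hJ hcJ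
    (div_nonneg hP₀.le hΛ.le) hδ hZ hZD hflat'
  have hP : 0 < Cν * P₀ / cJ := div_pos (mul_pos hCν hP₀) hcJ
  have hPoinc : Λ * ((∫ x, g x ^ 2 * (Θ x ^ 2 * w x) ∂μ) - (∫ x, g x * (Θ x ^ 2 * w x) ∂μ) ^ 2 / ∫ x in S, Θ x ^ 2 * w x ∂μ) ≤
      (Cν * P₀ / cJ) * ((1 / 2) * ∫ x, ∫ y, (g x - g y) ^ 2 * (Θ x * M x y * Θ y) ∂μ ∂μ) + Λ * (Cν * δ * C'ν) * ∫ x, g x ^ 2 * (Θ x ^ 2 * w x) ∂μ := by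
    have h := mul_le_mul_of_nonneg_left hV hΛ.le
    calc _ ≤ Λ * ((Cν * (P₀ / Λ) / cJ) * ((1 / 2) * ∫ x, ∫ y, (g x - g y) ^ 2 * (Θ x * M x y * Θ y) ∂μ ∂μ) + Cν * δ * C'ν * ∫ x, g x ^ 2 * (Θ x ^ 2 * w x) ∂μ) := h
      _ = _ := by field_simp
  have h := form_le_of_quasimode_of_poincare_slack (μ := μ) (η := η) hM hMb hsymm hΘ hΘb hΘ0 hg hgb hgS hw hwb hq hP hPoinc
  have e : (1 - Cν * δ * C'ν) / (Cν * P₀ / cJ) = (cJ / (Cν * P₀)) * (1 - Cν * δ * C'ν) := by field_simp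
  have e2 : 1 / (Cν * P₀ / cJ) = cJ / (Cν * P₀) := by field_simp
  rw [e, e2] at h
  exact h

end Slack

end Summit.QuantumFields.YangMills.Theorems.FemtoTransferGap.StiffDoor

end
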